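import Literature.NumberTheory.EllipticCurves.PoonenRainsCocycle
import Literature.NumberTheory.GaloisRepresentations.ContinuousH1ResCocycle
import Summits.BirchSwinnertonDyer.BirchSwinnertonDyer.Theorems.GenusKolyvaginAtTwoKramerParityOfTateQuadraticFormsCanonical
import HarnessLib

/-!
# Route `GenusKolyvaginAtTwo`, crux #2 `GenusPrimitiveSupplyAtTwo` (stmt-BirchSwinnertonDyer-22136):
# KRAMER PARITY VIA QUADRATIC SELMER STRUCTURES, part 5 — the GLOBAL Poonen–Rains class on `Γ_K`, its naturality
# `q_{K_v}(loc_v c) = loc_v q_K(c)`, and the RECIPROCITY (Q3) `∑_v can_v q_v(loc_v c) = 0` for `q_v = can_v ∘ prClass`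

Width seat `bsd-line-gk2-p4` g11 (cell `bsd-f1-sign2`); item (F3c) + (F5-reciprocity) of the lead's (gk2-p1 g10) memo
`Lines/genus-supply-pr-quadratic-form.md` §2, discharging hypothesis (Q3) of part 4's `kramerParity_of_tateQuadraticForms_canonical`
for THE Poonen–Rains quadratic map `ThetaLevelTwo.prClass` of the tree (`PoonenRainsCocycle.lean`, p644978). THEOREMS ONLY (no
definition, no named fact, no `sorry`); helper `--supports stmt-BirchSwinnertonDyer-22136`; no item is closed; BSD is not proved by any
of this.

* `continuous_conn_heisenbergMu`, `exists_global_twoCocycle` — for a continuous crossed homomorphism `ξ : Γ_K → E[2]` the obstruction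
  cochain `(σ, τ) ↦ χ_σ(ξ_τ) · m(ξ_σ, σξ_τ) ∈ μ₂` of the level-`2` theta datum `heisenbergMu W h2` ON `Γ_K` ITSELF is a continuous
  `2`-cocycle (the lead's `prCocycle` is the same construction on `Γ_L` for a `K`-field `L`; existence form, no definition);
* `prClass_res_oneCocycleClass` — **NATURALITY** `prClass W h2 L (res_L [ξ]) = res_L [conn ξ]` for every `K`-field `L`
  (`res_oneCocycleClass` / `map_twoCocycleClass`; pointwise `HeisenbergDatum.conn_comap`);
* **`sum_canonical_prClass_localization_eq_zero`** — (Q3): for every global class `c ∈ H¹(K, E[2])` and every finite `S` off which the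
  terms vanish, `∑_{v∈S} can_v (prClass W h2 K_v (loc_v c)) = 0` — Tate's reciprocity law for the Brauer group
  (`sumInvLocalizationEqZero_canonical_of_numberField`) applied to the GLOBAL class `[conn ξ] ∈ H²(K, μ₂)`;
* `tateQuadraticForm_prClass_Q3` — the same in the exact spelling of hypothesis (Q3) of `kramerParity_of_tateQuadraticForms_canonical`
  (level `((2 : ℕ) : ℤ)`, the quadratic datum `q v x := can_v (prClass W h2 K_v x)` written with the two-step level ascription of the
  API card `Lines/genus-supply-kramer-bridge.md` §1b).

References: [PoonenRains2012] Cor. 4.6, Thm. 4.14 (arXiv:1009.0287 §4); [KlagsbrunMazurRubin2013] Def. 3.3 (iii); [MilneADT2006]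
I Thm. 4.10 (b); [CasselsFrohlichANT1967] Ch. VII §11; [SerreGaloisCohomology1997] I §2.4, §5.7.
-/

set_option linter.dupNamespace false -- tree convention: `Summit.BirchSwinnertonDyer.BirchSwinnertonDyer.Theorems` (summit = sub-problem)
set_option autoImplicit false

noncomputable section

open scoped Classical ContRepresentation

namespace Summit.BirchSwinnertonDyer.BirchSwinnertonDyer.Theorems.GenusKolyKramer

open WeierstrassCurve Field NumberField IsDedekindDomain Function
open Literature.Algebra.Homology
open Literature.NumberTheory.EllipticCurves Literature.NumberTheory.EllipticCurves.ThetaLevelTwo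
open Literature.NumberTheory.GaloisRepresentations
open Literature.NumberTheory.GaloisRepresentations.DiscreteGaloisModule (mu MuCarrier)
open Literature.NumberTheory.GaloisCohomology

variable {K : Type} [Field K] [NumberField K] (W : WeierstrassCurve K) [W.IsElliptic] (h2 : (2 : K) ≠ 0)

/-! ## §1 The global obstruction cocycle on `Γ_K` -/

omit [NumberField K] in
/-- A continuous crossed homomorphism of `E[2]` (as a topological `Γ_K`-module) is a crossed homomorphism for the theta datum
`heisenbergMu`. [cite: SerreGaloisCohomology1997, I §5.1 (cocycles, crossed homomorphisms)] -/
theorem isCrossedHom_heisenbergMu_of_mem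
    (ξ : contOneCocycles (DiscreteGaloisModule.toTopRep (W.torsionGaloisModule 2))) :
    (heisenbergMu W h2).IsCrossedHom (fun σ => ξ.1 σ) := fun σ τ => ξ.2 σ τ

omit [NumberField K] in
/-- **Continuity of the global obstruction cochain** `(σ, τ) ↦ χ_σ(ξ_τ) + m(ξ_σ, ξ_{στ} − ξ_σ)` (the lead's `continuous_prFun`
with `Γ_L → Γ_K` replaced by the identity). [cite: SerreGaloisCohomology1997, I §2.2 (continuous cochains)] -/
theorem continuous_conn_heisenbergMu
    (ξ : contOneCocycles (DiscreteGaloisModule.toTopRep (W.torsionGaloisModule 2))) :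
    Continuous fun p : absoluteGaloisGroup K × absoluteGaloisGroup K =>
      (heisenbergMu W h2).conn (fun σ => ξ.1 σ) p.1 p.2 := by
  have hξ : Continuous (fun σ : absoluteGaloisGroup K => ξ.1 σ) := ξ.1.continuous
  have h1 : Continuous fun p : absoluteGaloisGroup K × absoluteGaloisGroup K =>
      (heisenbergMu W h2).χ p.1 (ξ.1 p.2) := by
    rw [continuous_discrete_rng]
    intro c
    rw [isOpen_iff_forall_mem_open]
    rintro ⟨σ₀, τ₀⟩ h0
    refine ⟨{σ | (heisenbergMu W h2).χ σ (ξ.1 τ₀) = c} ×ˢ {τ | ξ.1 τ = ξ.1 τ₀}, ?_, ?_, ?_⟩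
    · rintro ⟨σ, τ⟩ ⟨hσ, hτ⟩
      simp only [Set.mem_setOf_eq] at hσ hτ
      simp only [Set.mem_preimage, Set.mem_singleton_iff, hτ]
      exact hσ
    · exact ((isOpen_discrete {c}).preimage (continuous_heisenbergMu_χ W h2 (ξ.1 τ₀))).prod
        ((isOpen_discrete {ξ.1 τ₀}).preimage hξ)
    · exact ⟨h0, rfl⟩
  have hpair : Continuous fun p : absoluteGaloisGroup K × absoluteGaloisGroup K =>
      ((heisenbergMu W h2).χ p.1 (ξ.1 p.2), (ξ.1 p.1, ξ.1 (p.1 * p.2))) :=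
    h1.prodMk ((hξ.comp continuous_fst).prodMk (hξ.comp continuous_mul))
  have heq : (fun p : absoluteGaloisGroup K × absoluteGaloisGroup K => (heisenbergMu W h2).conn (fun σ => ξ.1 σ) p.1 p.2) =
      (fun t : MuCarrier K 2 × (geomTorsion W 2 × geomTorsion W 2) =>
        t.1 + (heisenbergMu W h2).m t.2.1 (t.2.2 - t.2.1)) ∘
      (fun p : absoluteGaloisGroup K × absoluteGaloisGroup K =>
        ((heisenbergMu W h2).χ p.1 (ξ.1 p.2), (ξ.1 p.1, ξ.1 (p.1 * p.2)))) := by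
    funext p
    have hc : (heisenbergMu W h2).ρ p.1 (ξ.1 p.2) = ξ.1 (p.1 * p.2) - ξ.1 p.1 := by
      have h := isCrossedHom_heisenbergMu_of_mem W h2 ξ p.1 p.2
      dsimp only at h
      rw [h, add_sub_cancel_left]
    rw [Function.comp_apply, HeisenbergDatum.conn_apply, hc]
  rw [heq]
  exact continuous_of_discreteTopology.comp hpair

omit [NumberField K] in
/-- **The global Poonen–Rains `2`-cocycle** (existence form): the obstruction cochain of `ξ` for `heisenbergMu W h2` is a continuous
`2`-cocycle of `μ₂` on `Γ_K` (`HeisenbergDatum.conn_cocycle`). [cite: PoonenRains2012, Cor. 4.6 (connecting map of the Heisenberg group)] -/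
theorem exists_global_twoCocycle
    (ξ : contOneCocycles (DiscreteGaloisModule.toTopRep (W.torsionGaloisModule 2))) :
    ∃ Φ : contTwoCocycles (DiscreteGaloisModule.toTopRep (mu K 2)),
      ∀ σ τ, Φ.1 (σ, τ) = (heisenbergMu W h2).conn (fun σ => ξ.1 σ) σ τ := by
  refine ⟨⟨⟨fun p => (heisenbergMu W h2).conn (fun σ => ξ.1 σ) p.1 p.2, continuous_conn_heisenbergMu W h2 ξ⟩,
    fun σ τ υ => ?_⟩, fun σ τ => rfl⟩
  have key := (heisenbergMu W h2).conn_cocycle (isCrossedHom_heisenbergMu_of_mem W h2 ξ) σ τ υ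
  rw [heisenbergMu_α, muAction_apply] at key
  exact key

/-! ## §2 Naturality: `q_L ∘ res = res ∘ q_K` -/

omit [NumberField K] in
/-- **NATURALITY of the Poonen–Rains class under restriction to a `K`-field `L`**: `prClass W h2 L (res_L [ξ]) = res_L [conn ξ]`
(the lead's local datum is the pull-back `heisenbergMu.comap (Γ_L → Γ_K)`, so the cocycles agree pointwise by
`HeisenbergDatum.conn_comap`; classes by `res_oneCocycleClass` / `map_twoCocycleClass`).
[cite: PoonenRains2012, §4.1 (functoriality in the field)] [cite: SerreGaloisCohomology1997, I §2.4] -/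
theorem prClass_res_oneCocycleClass (L : Type) [Field L] [Algebra K L]
    (ξ : contOneCocycles (DiscreteGaloisModule.toTopRep (W.torsionGaloisModule 2)))
    (Φ : contTwoCocycles (DiscreteGaloisModule.toTopRep (mu K 2)))
    (hΦ : ∀ σ τ, Φ.1 (σ, τ) = (heisenbergMu W h2).conn (fun σ => ξ.1 σ) σ τ) :
    haveI : CompactSpace (absoluteGaloisGroup K) := absoluteGaloisGroup_compactSpace K
    prClass W h2 L (galoisCohomology.res (W.torsionGaloisModule 2) L 1
        (oneCocycleClass (DiscreteGaloisModule.toTopRep (W.torsionGaloisModule 2)) ξ)) =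
      galoisCohomology.res (mu K 2) L 2 (twoCocycleClass (DiscreteGaloisModule.toTopRep (mu K 2)) Φ) := by
  haveI : CompactSpace (absoluteGaloisGroup K) := absoluteGaloisGroup_compactSpace K
  haveI : CompactSpace (absoluteGaloisGroup L) := absoluteGaloisGroup_compactSpace L
  rw [galoisCohomology.res_oneCocycleClass, prClass_oneCocycleClass]
  have hres : galoisCohomology.res (mu K 2) L 2 (twoCocycleClass (DiscreteGaloisModule.toTopRep (mu K 2)) Φ) =
      twoCocycleClass (DiscreteGaloisModule.toTopRep ((mu K 2).restrictField L))
        (contTwoCocycles.pullback (absGaloisRestrict K L)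
          (TopRep.ofHom ⟨ContinuousLinearMap.id ℤ (MuCarrier K 2), fun _ => rfl⟩ :
            TopRep.res (absGaloisRestrict K L : absoluteGaloisGroup L →* absoluteGaloisGroup K)
              (DiscreteGaloisModule.toTopRep (mu K 2)) ⟶ DiscreteGaloisModule.toTopRep ((mu K 2).restrictField L)) Φ) :=
    map_twoCocycleClass _ _ _ Φ
  rw [hres]
  congr 1
  apply Subtype.ext
  apply ContinuousMap.ext
  rintro ⟨σ, τ⟩
  rw [prCocycle_apply, contTwoCocycles.pullback_apply, hΦ]
  rfl

/-! ## §3 (Q3): reciprocity for `q_v = can_v ∘ prClass` -/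

/-- **RECIPROCITY (Q3) for the Poonen–Rains forms through THE canonical invariant maps**: for every global class
`c ∈ H¹(K, E[2])` and every finite set of places `S` off which the local values vanish,
`∑_{v∈S} can_v (prClass W h2 K_v (loc_v c)) = 0` — the local classes are the localisations of ONE global class `[conn ξ] ∈ H²(K, μ₂)`
(§1–§2), to which Tate's reciprocity law `sumInvLocalizationEqZero_canonical_of_numberField` applies (Poonen–Rains Thm. 4.14 / KMR
Def. 3.3 (iii)). [cite: PoonenRains2012, Thm. 4.14] [cite: MilneADT2006, Ch. I, Thm. 4.10(b)] -/
theorem sum_canonical_prClass_localization_eq_zero (c : galoisCohomology (W.torsionGaloisModule 2) 1)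
    (S : Finset (Place K))
    (hS : ∀ v ∉ S, LocalInvariants.canonical K 2 v
      (prClass W h2 (Place.Completion v) (galoisCohomology.localization (W.torsionGaloisModule 2) v 1 c)) = 0) :
    ∑ v ∈ S, LocalInvariants.canonical K 2 v
      (prClass W h2 (Place.Completion v) (galoisCohomology.localization (W.torsionGaloisModule 2) v 1 c)) = 0 := by
  haveI : NeZero (2 : ℕ) := ⟨two_ne_zero⟩
  haveI : CompactSpace (absoluteGaloisGroup K) := absoluteGaloisGroup_compactSpace K
  obtain ⟨ξ, rfl⟩ := oneCocycleClass_surjective _ c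
  obtain ⟨Φ, hΦ⟩ := exists_global_twoCocycle W h2 ξ
  have hnat : ∀ v : Place K, prClass W h2 (Place.Completion v)
      (galoisCohomology.localization (W.torsionGaloisModule 2) v 1
        (oneCocycleClass (DiscreteGaloisModule.toTopRep (W.torsionGaloisModule 2)) ξ)) =
      galoisCohomology.localization (mu K 2) v 2 (twoCocycleClass (DiscreteGaloisModule.toTopRep (mu K 2)) Φ) :=
    fun v => prClass_res_oneCocycleClass W h2 (Place.Completion v) ξ Φ hΦ
  simp only [hnat] at hS ⊢
  exact sumInvLocalizationEqZero_canonical_of_numberField K 2 _ S hS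

/-- **(Q3) in the spelling of `kramerParity_of_tateQuadraticForms_canonical`** (level `((2 : ℕ) : ℤ)`; the quadratic datum
`q v x := can_v (prClass W h2 K_v x)` written with the two-step level ascription of the API card): for every global class `c` and
finite `S`, if `q_v(loc_v c) = 0` off `S` then `∑_{v∈S} q_v(loc_v c) = 0`. [cite: PoonenRains2012, Thm. 4.14] -/
theorem tateQuadraticForm_prClass_Q3 (c : galoisCohomology (W.torsionGaloisModule ((2 : ℕ) : ℤ)) 1) (S : Finset (Place K))
    (hS : ∀ v ∉ S, (fun (v : Place K) (x : galoisCohomology ((W.torsionGaloisModule ((2 : ℕ) : ℤ)).toLocal v) 1) =>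
        LocalInvariants.canonical K 2 v (prClass W h2 (Place.Completion v)
          (show galoisCohomology ((W.torsionGaloisModule (2 : ℤ)).toLocal v) 1 from x))) v
      (galoisCohomology.localization (W.torsionGaloisModule ((2 : ℕ) : ℤ)) v 1 c) = 0) :
    ∑ v ∈ S, (fun (v : Place K) (x : galoisCohomology ((W.torsionGaloisModule ((2 : ℕ) : ℤ)).toLocal v) 1) =>
        LocalInvariants.canonical K 2 v (prClass W h2 (Place.Completion v)
          (show galoisCohomology ((W.torsionGaloisModule (2 : ℤ)).toLocal v) 1 from x))) v
      (galoisCohomology.localization (W.torsionGaloisModule ((2 : ℕ) : ℤ)) v 1 c) = 0 :=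
  sum_canonical_prClass_localization_eq_zero W h2 (show galoisCohomology (W.torsionGaloisModule (2 : ℤ)) 1 from c) S hS

end Summit.BirchSwinnertonDyer.BirchSwinnertonDyer.Theorems.GenusKolyKramer

end
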